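import Literature.Topology.FourManifolds.IntersectionFormEvenOfTube
import Literature.Topology.FourManifolds.FramedTubeWithBoundary
import HarnessLib

/-!
# Kosinski X.(3.1): the intersection form of a `π`-manifold bounded by a homotopy sphere is even
— from the closed-model atlas

The tree's named fact
`Literature.Topology.FourManifolds.HomotopySphere.isEven_intersectionForm_closedModel`
(`HomotopySpheresBPOrderSignatureLeaves.lean`; Kosinski, *Differential Manifolds* (1993), Ch. X,
Prop. (3.1), p. 205, evenness half) is PROVED here from the single remaining input

* `HomotopySphere.nonempty_chartedSpace_closedModel` (Kosinski X, proof of (3.3) with VIII.4.6: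
  for `n ≥ 5` the closed model `Ŵ = W ∪ cone(∂W)` of a null-cobordism of a homotopy `n`-sphere
  is a closed topological manifold — collars and `cone(Sⁿ) ≈ ℝⁿ⁺¹`),

as `isEven_intersectionForm_closedModel_of_chartedSpace`. The proof is the Wu-class route, all of
whose pieces are proved in the tree: the framed closed tube of the s-parallelisable `W` in a sphere
(`FramedTubeWithBoundary.exists_closedTube`: Whitney embedding, the explicit stable normal frame
of Kervaire–Milnor's proof of Thm. 3.1, local injectivity up to the boundary, invariance of
domain), the collapse onto the iterated suspension of `Ŵ` and its non-vanishing on top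
cohomology, the suspension isomorphism and the stability of the Steenrod squares, `Sq²ᵐ y = y²`,
`Hⁿ⁺¹(Ŵ; ℤ/2)` one-dimensional, and the reduction of the integral pairing modulo `2`
(`IntersectionFormEvenOfTube.isEven_intersectionForm_of_tube`). No named facts are introduced.

## References

* A. Kosinski, *Differential Manifolds*, Academic Press 1993, Ch. X Prop. (3.1) p. 205, (3.3).
  [Kosinski1993]
* J. Milnor, J. Stasheff, *Characteristic classes*, Princeton UP 1974, §18, Thm. 11.14.
  [MilnorStasheff1974]
-/

noncomputable section

open scoped Manifold
open Literature.AlgebraicTopology.Homotopy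

namespace Literature.Topology.FourManifolds

/-- **Kosinski X.(3.1), evenness, from the closed-model atlas**: the named fact
`HomotopySphere.isEven_intersectionForm_closedModel` follows from
`HomotopySphere.nonempty_chartedSpace_closedModel` (applicable since `n + 1 = 4m`, `1 < m` give
`n ≥ 7 ≥ 5`). The `π`-manifold hypothesis supplies the framed tube
(`FramedTube.exists_closedTube` for the model `𝓡∂ (n + 1)`), and `isEven_intersectionForm_of_tube`
concludes; the connectivity hypotheses of the fact are not needed. [cite: Kosinski1993, Ch. X, Prop. (3.1) (p. 205)] -/
theorem HomotopySphere.isEven_intersectionForm_closedModel_of_chartedSpace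
    (hC : HomotopySphere.nonempty_chartedSpace_closedModel) :
    HomotopySphere.isEven_intersectionForm_closedModel := by
  intro n m hnm hm S c μ' hsc _ hπ
  obtain ⟨_inst⟩ := hC n (by omega) S c
  obtain ⟨N, t, ht, hinj, hopen⟩ := FramedTube.exists_closedTube (I := 𝓡∂ (n + 1)) (W := c.W)
    (n + 1) finrank_euclideanSpace_fin hπ
  exact isEven_intersectionForm_of_tube hnm S c μ' hsc rfl t ht hinj hopen

end Literature.Topology.FourManifolds
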